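import Summits.Ventures.CertifiedArithmetic.Expansions.Orient2dStageCBounds
import Literature.ComputerArithmetic.GraillatLefevreMuller2015.IntegerPowers
import Mathlib.Tactic.Linarith
import Mathlib.Tactic.Positivity
import Mathlib.Tactic.Ring
import Mathlib.Tactic.NormNum

/-!
# ORIENT3D, stage C, part 3: the margins of the constants

Shared numerical engines serving client cells; rigour lives in the verifiers; every published number
belongs to a client cell's ledger, not to the engines group.  NEW WORK: the soundness theorem of
part 2 (`Orient3dStageCBounds.orient3d_stageC_sign_of_bounds`, our transcription of
`orient3dadapt`'s stage C as hypotheses between rationals; nothing is claimed about the C code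
itself) holds for any
constants `K_C`, `K_R` and any estimate error `δ` (`|det_B − B| ≤ δ|B|`) under the two margins
  (MC) `23ε² + 70ε³ + 123ε⁴ + 145ε⁵ + 113ε⁶ + 56ε⁷ + 16ε⁸ + 2ε⁹ < (1 − ε)⁷ K_C`,
  (MR) `δ < (1 − δ)(1 − ε)³ K_R`.
This file, which imports neither part, evaluates them for concrete constants (`ε = 2^−p`).

THE RESULTS.
* (MC) for Shewchuk's `K_C = o3derrboundC = (26 + 288ε)ε²` (`predicates.c`, `exactinit`):
  `o3derrboundC_margin` — it holds for every `p ≥ 4` (on `0 < ε ≤ 1/32` the difference is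
  `ε²(3 + 36ε − 1593ε² + 4993ε³ − 9283ε⁴ + 9478ε⁵ − 5882ε⁶ + 1988ε⁷ − 288ε⁸) > 0`,
  `o3derrboundC_margin_of_le_32`; `p = 4` by evaluation) and fails at `p = 3`
  (`o3derrboundC_margin_fails_three`).  CERTIFIED, in the sense of part 2, for `p ≥ 4`.
* (MR) with `δ = 3ε` and Shewchuk's `K_R = resulterrbound = (3 + 8ε)ε`:
  `resulterrbound_margin_three_fails` — it fails at EVERY precision `p ≥ 2` (the difference is
  `−ε²(10 + 12ε − 66ε² + 71ε³ − 24ε⁴) < 0`).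
* (MR) with `δ = 3ε` and OUR `K_R = o3dresulterrbound24 = (3 + 24ε)ε` (a float: `(3·2^(p−3) + 3)·
  2^(3−2p)`, `isFloat_o3dresulterrbound24`): `o3dresulterrbound24_margin` — it holds for every
  `p ≥ 4` (difference `ε²(6 − 108ε + 258ε² − 231ε³ + 72ε⁴)`, positive on `0 < ε ≤ 1/16` although
  `6 − 108ε + 258ε²` vanishes already at `ε ≈ 0.0659`).
* (MR) with `δ = 2ε` and Shewchuk's `(3 + 8ε)ε`: `resulterrbound_margin_two` — it holds for every
  `p ≥ 3` (difference `ε(1 − 7ε − 13ε² + 51ε³ − 50ε⁴ + 16ε⁵)`; `p = 3` by evaluation, with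
  `2^−13` to spare).

THE FINDING (recorded, not adjudicated).  Whether Table 3, line C of the paper is certified by the
analysis of part 2 depends only on the estimate error `δ` granted for the stage-B expansion:
`δ = 2ε` suffices from `p ≥ 3` (and `δ = 2.5ε` from `p ≥ 5`, by evaluation of the same polynomial),
`δ = 3ε` never does.  The paper (§2.7) asserts that `estimate` errs by less than one ulp, which is
false for general nonoverlapping expansions (`Orient2dEstimate`); the bound this development works
with for the weakly nonoverlapping expansions stage B produces is `δ = 3ε` (exhaustive
small-precision searches found at most `2.38ε`, cf. `EstimateWeakExpansion`).  Under `δ = 3ε` the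
analysis certifies `(K_C, K_R) = ((26 + 288ε)ε², (3 + 24ε)ε)` for `p ≥ 4`, i.e. for binary32 and
binary64.  A failed margin is a gap in a sufficient condition, not an input on which `predicates.c`
errs; we know of none.
References: J. R. Shewchuk, Discrete Comput. Geom. 18 (1997) 305–363, §4.4, Table 3, and
`predicates.c` (`exactinit`, `orient3dadapt`) [Shewchuk1997].
-/

namespace Summit.Ventures.CertifiedArithmetic.Expansions

open Literature.ComputerArithmetic.JeannerodRump2018
open Literature.ComputerArithmetic.Shewchuk1997
open Literature.ComputerArithmetic.BoldoMuller2011 (unitRoundoff_le_sixteenth)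
open Literature.ComputerArithmetic.GraillatLefevreMuller2015 (unitRoundoff_le_of_five_le)

variable {p : ℕ} {emin : ℤ}

/-! ## Margin (MC): the permanent coefficient `(26 + 288ε)ε²` -/

/-- (MC) for `(26 + 288ε)ε²` on `0 < ε ≤ 1/32`: the difference is `ε²(3 + 36ε − 1593ε² + 4993ε³
− 9283ε⁴ + 9478ε⁵ − 5882ε⁶ + 1988ε⁷ − 288ε⁸)` with `1593ε² ≤ 1593ε/32 < 3 + 36ε` and the three
remaining pairs nonnegative. -/
theorem o3derrboundC_margin_of_le_32 {u : ℚ} (hu0 : 0 < u) (hu : u ≤ 1 / 32) :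
    23 * u ^ 2 + 70 * u ^ 3 + 123 * u ^ 4 + 145 * u ^ 5 + 113 * u ^ 6 + 56 * u ^ 7 + 16 * u ^ 8
      + 2 * u ^ 9 < (1 - u) ^ 7 * ((26 + 288 * u) * u * u) := by
  have hkey : (1 - u) ^ 7 * ((26 + 288 * u) * u * u) - (23 * u ^ 2 + 70 * u ^ 3 + 123 * u ^ 4
      + 145 * u ^ 5 + 113 * u ^ 6 + 56 * u ^ 7 + 16 * u ^ 8 + 2 * u ^ 9) = u ^ 2 * (3 + 36 * u
      - 1593 * u ^ 2 + 4993 * u ^ 3 - 9283 * u ^ 4 + 9478 * u ^ 5 - 5882 * u ^ 6 + 1988 * u ^ 7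
      - 288 * u ^ 8) := by
    ring
  have h1 : 0 < 3 + 36 * u - 1593 * u ^ 2 := by
    have e : u ^ 2 ≤ u * (1 / 32) := by
      rw [pow_two]
      exact mul_le_mul_of_nonneg_left hu hu0.le
    linarith
  have h2 : 0 ≤ 4993 * u ^ 3 - 9283 * u ^ 4 := by
    have h : 0 ≤ 4993 - 9283 * u := by linarith
    have := mul_nonneg (pow_nonneg hu0.le 3) h
    linarith
  have h3 : 0 ≤ 9478 * u ^ 5 - 5882 * u ^ 6 := by
    have h : 0 ≤ 9478 - 5882 * u := by linarith
    have := mul_nonneg (pow_nonneg hu0.le 5) h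
    linarith
  have h4 : 0 ≤ 1988 * u ^ 7 - 288 * u ^ 8 := by
    have h : 0 ≤ 1988 - 288 * u := by linarith
    have := mul_nonneg (pow_nonneg hu0.le 7) h
    linarith
  have hpoly : 0 < 3 + 36 * u - 1593 * u ^ 2 + 4993 * u ^ 3 - 9283 * u ^ 4 + 9478 * u ^ 5
      - 5882 * u ^ 6 + 1988 * u ^ 7 - 288 * u ^ 8 := by
    linarith
  have := mul_pos (pow_pos hu0 2) hpoly
  rw [← hkey] at this
  linarith

/-- (MC) for `(26 + 288ε)ε²` fails at `ε = 1/8` (`p = 3`). -/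
theorem o3derrboundC_margin_fails_three :
    ¬ (23 * (1 / 8 : ℚ) ^ 2 + 70 * (1 / 8 : ℚ) ^ 3 + 123 * (1 / 8 : ℚ) ^ 4 + 145 * (1 / 8 : ℚ) ^ 5
      + 113 * (1 / 8 : ℚ) ^ 6 + 56 * (1 / 8 : ℚ) ^ 7 + 16 * (1 / 8 : ℚ) ^ 8 + 2 * (1 / 8 : ℚ) ^ 9
      < (1 - 1 / 8) ^ 7 * ((26 + 288 * (1 / 8)) * (1 / 8) * (1 / 8 : ℚ))) := by
  norm_num

/-! ## Margin (MR): the `|det_B|` coefficient against the estimate error -/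

/-- (MR) with `δ = 3ε` FAILS for Shewchuk's `(3 + 8ε)ε`, for every `0 < ε ≤ 1/4`: the difference
is `−ε²(10 + 12ε − 66ε² + 71ε³ − 24ε⁴) < 0`. -/
theorem resulterrbound_margin_three_false {u : ℚ} (hu0 : 0 < u) (hu : u ≤ 1 / 4) :
    ¬ (3 * u < (1 - 3 * u) * ((1 - u) ^ 3 * ((3 + 8 * u) * u))) := by
  intro h
  have hkey : (1 - 3 * u) * ((1 - u) ^ 3 * ((3 + 8 * u) * u)) - 3 * u
      = -(u ^ 2 * (10 + 12 * u - 66 * u ^ 2 + 71 * u ^ 3 - 24 * u ^ 4)) := by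
    ring
  have hpoly : 0 ≤ 10 + 12 * u - 66 * u ^ 2 + 71 * u ^ 3 - 24 * u ^ 4 := by
    have e : u ^ 2 ≤ u * (1 / 4) := by
      rw [pow_two]
      exact mul_le_mul_of_nonneg_left hu hu0.le
    have h2 : 0 ≤ 71 * u ^ 3 - 24 * u ^ 4 := by
      have h : 0 ≤ 71 - 24 * u := by linarith
      have := mul_nonneg (pow_nonneg hu0.le 3) h
      linarith
    linarith
  have := mul_nonneg (pow_nonneg hu0.le 2) hpoly
  linarith

/-- (MR) with `δ = 3ε` HOLDS for `(3 + 24ε)ε` on `0 < ε ≤ 1/16`: the difference is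
`ε²(6 − 108ε + 258ε² − 231ε³ + 72ε⁴)`; with `231ε³ ≤ (231/16)ε²` the quadratic
`6 − 108ε + (258 − 231/16)ε²` is convex and decreasing on `[0, 1/16]`, where it ends at
`≈ 0.2014`. -/
theorem o3dresulterrbound24_margin_of_le_16 {u : ℚ} (hu0 : 0 < u) (hu : u ≤ 1 / 16) :
    3 * u < (1 - 3 * u) * ((1 - u) ^ 3 * ((3 + 24 * u) * u)) := by
  have hkey : (1 - 3 * u) * ((1 - u) ^ 3 * ((3 + 24 * u) * u)) - 3 * u
      = u ^ 2 * (6 - 108 * u + 258 * u ^ 2 - 231 * u ^ 3 + 72 * u ^ 4) := by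
    ring
  have e1 : u ^ 3 ≤ u ^ 2 * (1 / 16) := by
    rw [pow_succ]
    exact mul_le_mul_of_nonneg_left hu (pow_nonneg hu0.le 2)
  have e2 : 0 ≤ u ^ 4 := pow_nonneg hu0.le 4
  have e3 : 0 ≤ (u - 1 / 16) ^ 2 := sq_nonneg _
  have hpoly : 0 < 6 - 108 * u + 258 * u ^ 2 - 231 * u ^ 3 + 72 * u ^ 4 := by
    nlinarith [e1, e2, e3, hu]
  have := mul_pos (pow_pos hu0 2) hpoly
  rw [← hkey] at this
  linarith

/-- (MR) with `δ = 2ε` HOLDS for Shewchuk's `(3 + 8ε)ε` on `0 < ε ≤ 1/16`: the difference is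
`ε(1 − 7ε − 13ε² + 51ε³ − 50ε⁴ + 16ε⁵)`. -/
theorem resulterrbound_margin_two_of_le_16 {u : ℚ} (hu0 : 0 < u) (hu : u ≤ 1 / 16) :
    2 * u < (1 - 2 * u) * ((1 - u) ^ 3 * ((3 + 8 * u) * u)) := by
  have hkey : (1 - 2 * u) * ((1 - u) ^ 3 * ((3 + 8 * u) * u)) - 2 * u
      = u * (1 - 7 * u - 13 * u ^ 2 + 51 * u ^ 3 - 50 * u ^ 4 + 16 * u ^ 5) := by
    ring
  have hpoly : 0 < 1 - 7 * u - 13 * u ^ 2 + 51 * u ^ 3 - 50 * u ^ 4 + 16 * u ^ 5 := by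
    have e : u ^ 2 ≤ u * (1 / 16) := by
      rw [pow_two]
      exact mul_le_mul_of_nonneg_left hu hu0.le
    have h2 : 0 ≤ 51 * u ^ 3 - 50 * u ^ 4 := by
      have h : 0 ≤ 51 - 50 * u := by linarith
      have := mul_nonneg (pow_nonneg hu0.le 3) h
      linarith
    have h3 : 0 ≤ u ^ 5 := pow_nonneg hu0.le 5
    linarith
  have := mul_pos hu0 hpoly
  rw [← hkey] at this
  linarith

/-! ## The constants -/

/-- Shewchuk's coefficient of Table 3, line C on the permanent (`predicates.c` `exactinit`:
`o3derrboundC = (26.0 + 288.0 * epsilon) * epsilon * epsilon`).  CERTIFIED by the analysis of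
part 2 for `p ≥ 4` (`o3derrboundC_margin`). -/
def o3derrboundC (p : ℕ) : ℚ := (26 + 288 * unitRoundoff p) * unitRoundoff p * unitRoundoff p

/-- OUR coefficient of `|det_B|` under the estimate error `δ = 3ε`: `(3 + 24ε)ε` (Shewchuk's is
`resulterrbound = (3 + 8ε)ε`, `Orient2dStageCBounds`).  CERTIFIED for `p ≥ 4`
(`o3dresulterrbound24_margin`). -/
def o3dresulterrbound24 (p : ℕ) : ℚ := (3 + 24 * unitRoundoff p) * unitRoundoff p

/-- `o3derrboundC = (26·2^p + 288)·2^(−3p)` lies on the grid `2^(−3p) ℤ`. -/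
theorem onGrid_o3derrboundC (p : ℕ) : OnGrid (-(3 * (p : ℤ))) (o3derrboundC p) := by
  refine ⟨26 * 2 ^ p + 288, ?_⟩
  unfold o3derrboundC unitRoundoff
  have h2 : (2 : ℚ) ^ p ≠ 0 := pow_ne_zero _ (by norm_num)
  rw [show (-(3 * (p : ℤ))) = -((p : ℤ) + (p : ℤ) + (p : ℤ)) by ring, zpow_neg,
    zpow_add₀ (by norm_num), zpow_add₀ (by norm_num), zpow_natCast]
  push_cast
  field_simp

/-- `o3dresulterrbound24 = (3·2^p + 24)·2^(−2p)` lies on the grid `2^(−2p) ℤ`. -/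
theorem onGrid_o3dresulterrbound24 (p : ℕ) : OnGrid (-(2 * (p : ℤ))) (o3dresulterrbound24 p) := by
  refine ⟨3 * 2 ^ p + 24, ?_⟩
  unfold o3dresulterrbound24 unitRoundoff
  have h2 : (2 : ℚ) ^ p ≠ 0 := pow_ne_zero _ (by norm_num)
  rw [show (-(2 * (p : ℤ))) = -((p : ℤ) + (p : ℤ)) by ring, zpow_neg, zpow_add₀ (by norm_num),
    zpow_natCast]
  push_cast
  field_simp

/-- `o3dresulterrbound24 = (3·2^(p−3) + 3)·2^(3−2p)` is a float of `F(p, emin)` for `p ≥ 3` and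
`emin ≤ 3 − 2p`. -/
theorem isFloat_o3dresulterrbound24 (hp : 3 ≤ p) (hemin : emin ≤ 3 - 2 * (p : ℤ)) :
    IsFloat p emin (o3dresulterrbound24 p) := by
  refine ⟨3 * 2 ^ (p - 3) + 3, 3 - 2 * (p : ℤ), ?_, hemin, ?_⟩
  · have habs : |(3 : ℤ) * 2 ^ (p - 3) + 3| = 3 * 2 ^ (p - 3) + 3 := abs_of_nonneg (by positivity)
    rw [habs]
    have h1 : (1 : ℤ) ≤ 2 ^ (p - 3) := one_le_pow₀ (by norm_num)
    calc (3 : ℤ) * 2 ^ (p - 3) + 3 < 8 * 2 ^ (p - 3) := by linarith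
      _ = 2 ^ (p - 3 + 3) := by ring
      _ = 2 ^ p := by congr 1; omega
  · unfold o3dresulterrbound24 unitRoundoff
    have h2 : (2 : ℚ) ≠ 0 := by norm_num
    rw [show (3 - 2 * (p : ℤ)) = -(((p - 3 : ℕ) : ℤ)) + (-(((p - 3 : ℕ) : ℤ)) + (-3)) by omega,
      zpow_add₀ h2, zpow_add₀ h2, zpow_neg, zpow_natCast,
      show (2 : ℚ) ^ p = 2 ^ (p - 3) * 2 ^ 3 by rw [← pow_add]; congr 1; omega]
    push_cast
    field_simp
    ring

/-! ## The margins at `ε = 2^−p` -/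

/-- (MC) for `o3derrboundC`, every `p ≥ 4`. -/
theorem o3derrboundC_margin (hp : 4 ≤ p) :
    23 * unitRoundoff p ^ 2 + 70 * unitRoundoff p ^ 3 + 123 * unitRoundoff p ^ 4
      + 145 * unitRoundoff p ^ 5 + 113 * unitRoundoff p ^ 6 + 56 * unitRoundoff p ^ 7
      + 16 * unitRoundoff p ^ 8 + 2 * unitRoundoff p ^ 9
      < (1 - unitRoundoff p) ^ 7 * o3derrboundC p := by
  unfold o3derrboundC
  rcases Nat.lt_or_ge p 5 with h5 | h5
  · obtain rfl : p = 4 := by omega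
    unfold unitRoundoff
    norm_num
  · exact o3derrboundC_margin_of_le_32 (by unfold unitRoundoff; positivity)
      (unitRoundoff_le_of_five_le h5)

/-- (MR) with `δ = 3ε` for `o3dresulterrbound24`, every `p ≥ 4`. -/
theorem o3dresulterrbound24_margin (hp : 4 ≤ p) :
    3 * unitRoundoff p
      < (1 - 3 * unitRoundoff p) * ((1 - unitRoundoff p) ^ 3 * o3dresulterrbound24 p) := by
  unfold o3dresulterrbound24
  exact o3dresulterrbound24_margin_of_le_16 (by unfold unitRoundoff; positivity)
    (unitRoundoff_le_sixteenth hp)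

/-- (MR) with `δ = 3ε` for Shewchuk's `resulterrbound`, NO `p ≥ 2`. -/
theorem resulterrbound_margin_three_fails (hp : 2 ≤ p) :
    ¬ (3 * unitRoundoff p
      < (1 - 3 * unitRoundoff p) * ((1 - unitRoundoff p) ^ 3 * resulterrbound p)) := by
  unfold resulterrbound
  have hq : unitRoundoff p ≤ 1 / 4 := by
    unfold unitRoundoff
    have h : (4 : ℚ) ≤ 2 ^ p := by
      calc (4 : ℚ) = 2 ^ 2 := by norm_num
        _ ≤ 2 ^ p := pow_le_pow_right₀ (by norm_num) hp
    exact one_div_le_one_div_of_le (by norm_num) h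
  exact resulterrbound_margin_three_false (by unfold unitRoundoff; positivity) hq

/-- (MR) with `δ = 2ε` for Shewchuk's `resulterrbound`, every `p ≥ 3`. -/
theorem resulterrbound_margin_two (hp : 3 ≤ p) :
    2 * unitRoundoff p
      < (1 - 2 * unitRoundoff p) * ((1 - unitRoundoff p) ^ 3 * resulterrbound p) := by
  unfold resulterrbound
  rcases Nat.lt_or_ge p 4 with h4 | h4
  · obtain rfl : p = 3 := by omega
    unfold unitRoundoff
    norm_num
  · exact resulterrbound_margin_two_of_le_16 (by unfold unitRoundoff; positivity)
      (unitRoundoff_le_sixteenth h4)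

end Summit.Ventures.CertifiedArithmetic.Expansions
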